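import Literature.AnabelianGeometry.EtaleTheta.FrobenioidThetaDivisors
import HarnessLib

/-!
# [EtTh] Proposition 5.3 (iv): the closure of the named fact `PreservesCspToNcsp` over the LOCAL STUB
# `DivisorPrimeData` fails at every Θ-Frobenioid with a prime-permuting automorphism of `Φ(A_⊚)` (FACT-LIST row F-0560)

Mochizuki, *The étale theta function …*, Publ. RIMS **45** (2009), Prop. 5.3 (iv), p. 325 (PDF p. 99): `Ψ^Φ_{A_⊚}`
preserves "the natural surjection `Prime(Φ(A_⊚))^csp ↠ Prime(Φ(A_⊚))^ncsp`" [cite: MochizukiEtTh2009, Prop 5.3 (iv)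
p.325 (PDF p.99)].  abc-iut cell, block F (fact-proving wave), seat abc-iut-f-004, FROZEN FACT-LIST row **F-0560**
(`FrobenioidThetaDivisors.PreservesCspToNcsp`, kernel_closedness = parametrised).

The row's declaration (abc-iut-L2-t4, `FrobenioidThetaDivisors.lean`) is a SCHEMA over the Θ-Frobenioid `𝔉`, the
LOCAL STUB `𝔓 : DivisorPrimeData 𝔉` (`TODO-merge(abc-iut-found, abc-iut-L2-t3)`: cuspidal primes, component
isomorphisms, the surjection `cspToNcsp`, the labels `Prime^ncsp ≃ ℤ` — ARBITRARY data), the self-equivalence `Ψ`, the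
isomorphism `ι : Ψ(A_⊚) ≅ A_⊚`, the `Ψ`-induced isomorphism of divisor monoids `e`, and Prop. 5.3 (i) on primes `hc`.
Print's (iv) is about the GEOMETRIC surjection ("the irreducible component of the special fiber that contains the
cusp(s)"); over arbitrary stub data the clause cannot hold uniformly.  This proof-only file makes that precise in the
kernel:

* `FrobenioidThetaDivisors.psiPhi_refl` — for `Ψ = 𝟭`, `ι = id`, `Ψ^Φ_{A_⊚}` IS the given automorphism `e` of `Φ(A_⊚)`;
* **`FrobenioidThetaDivisors.exists_not_preservesCspToNcsp`** — at ANY `𝔉` whose divisor monoid `Φ(A_⊚)` admits an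
  automorphism `σ` and a `σ`-stable set of primes `N ≃ ℤ` ("non-cuspidal") whose complement surjects onto `N`
  ("cuspidal"), with a `σ`-FIXED prime `𝔞` outside `N` whose image `f 𝔞 ∈ N` is `σ`-MOVED, and mutually isomorphic
  primary components (all as for the printed `Φ(A_⊚)`: the free monoid on the primes of the infinite chain of
  projective lines with its cusps, [EtTh] p. 324–325, with `σ` a permutation of primes), there are stub data `𝔓` and a
  proof `hc` of (i) on primes with `¬ PreservesCspToNcsp 𝔓 𝟭 (Iso.refl A_⊚) σ hc`;
* `FrobenioidThetaDivisors.not_forall_preservesCspToNcsp_of_config` — hence the closure of the row over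
  `(𝔓, Ψ, ι, e, hc)` is false at every such `𝔉`.
CONSEQUENCE (plan/FACT-LIST.md R5): F-0560 is admissible AT NAMED INSTANCES ONLY — the instance form is
abc-iut-L2-d4's `FrobenioidThetaDivisors.preservesCspToNcsp_of_criterion` (`Discharge/Sec5Prop53Surjection.lean`,
modulo the printed description of the surjection, GAP G-L2d4-2); a hypothesis quantifying over all `DivisorPrimeData`
would be unsatisfiable at every non-degenerate `𝔉`.  No inhabitant of `ThetaFrobenioid` is constructed here (none with
infinitely many primes exists in the tree), so the full universal closure over `𝔉` is not itself decided.

HONEST FRAMING: a statement about the TYPED stub interface, not about the divisor monoid of the tempered Frobenioid of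
a Tate curve; typed ≠ proved; no side is taken on [IUTchIII] Cor. 3.12.
-/

namespace Literature.AnabelianGeometry.EtaleTheta

open CategoryTheory
open Literature.AlgebraicGeometry.Frobenioids

universe w v v' u u'

namespace FrobenioidThetaDivisors

variable {C : Type u} [Category.{v} C] {D : Type u'} [Category.{v'} D] (𝔉 : ThetaFrobenioid.{w} C D)

/-- For the identity self-equivalence `Ψ = 𝟭_C` and the identity `ι : A_⊚ ≅ A_⊚`, the automorphism `Ψ^Φ_{A_⊚}` of
`Φ(A_⊚)` is the given isomorphism of divisor monoids `e` (pull-back along `id^bs` is the identity).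
[cite: MochizukiEtTh2009, Prop 5.3 p.325 (PDF p.99)] -/
theorem psiPhi_refl (e : 𝔉.PhiAcirc ≃* 𝔉.PhiAcirc) :
    psiPhi 𝔉 (CategoryTheory.Equivalence.refl (C := C)) (Iso.refl 𝔉.Acirc) e = e := by
  apply MulEquiv.ext
  intro a
  change 𝔉.pre.pull (𝔉.base.map (𝟙 𝔉.Acirc)) (e a) = e a
  rw [CategoryTheory.Functor.map_id, 𝔉.pre.pull_id]

/-- **F-0560: stub data violating Prop. 5.3 (iv) exist at every Θ-Frobenioid with a prime-permuting automorphism.**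
Given an automorphism `σ` of `Φ(A_⊚)`, a `σ`-stable set of primes `N ≃ ℤ` whose complement surjects onto it by `f`,
a `σ`-fixed prime `𝔞 ∉ N` with `σ(f 𝔞) ≠ f 𝔞`, and mutually isomorphic primary components, the LOCAL STUB
`DivisorPrimeData` is inhabited by `𝔓 := (cuspidal := ∉ N, cspToNcsp := f, …)`, Prop. 5.3 (i) on primes holds for
`Ψ^Φ_{A_⊚} = σ` (`Ψ = 𝟭`, `ι = id`), and (iv) FAILS: `f(σ𝔞) = f 𝔞 ≠ σ(f 𝔞)`.
[cite: MochizukiEtTh2009, Prop 5.3 (iv) p.325 (PDF p.99)] -/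
theorem exists_not_preservesCspToNcsp (σ : 𝔉.PhiAcirc ≃* 𝔉.PhiAcirc) (N : Set (Primes 𝔉.PhiAcirc))
    (hN : ∀ 𝔭, Primes.congr σ 𝔭 ∈ N ↔ 𝔭 ∈ N) (eN : N ≃ ℤ) (f : {𝔭 // 𝔭 ∉ N} → N)
    (hf : Function.Surjective f) (𝔞 : Primes 𝔉.PhiAcirc) (h𝔞 : 𝔞 ∉ N) (hσ𝔞 : Primes.congr σ 𝔞 = 𝔞)
    (hmove : Primes.congr σ (f ⟨𝔞, h𝔞⟩ : Primes 𝔉.PhiAcirc) ≠ f ⟨𝔞, h𝔞⟩)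
    (hiso : ∀ 𝔭 𝔮 : Primes 𝔉.PhiAcirc, Nonempty (𝔭.submonoid ≃* 𝔮.submonoid)) :
    ∃ (𝔓 : DivisorPrimeData 𝔉) (hc : CuspPreserved 𝔓 (CategoryTheory.Equivalence.refl (C := C)) (Iso.refl 𝔉.Acirc) σ),
      ¬ PreservesCspToNcsp 𝔓 (CategoryTheory.Equivalence.refl (C := C)) (Iso.refl 𝔉.Acirc) σ hc := by
  classical
  let 𝔓 : DivisorPrimeData 𝔉 :=
    { IsCuspidalElt := fun a => ∃ h : IsPrimary a, Quotient.mk (primarySetoid 𝔉.PhiAcirc) ⟨a, h⟩ ∉ N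
      IsNonCuspidalElt := fun a => ∃ h : IsPrimary a, Quotient.mk (primarySetoid 𝔉.PhiAcirc) ⟨a, h⟩ ∈ N
      IsCuspidal := fun 𝔭 => 𝔭 ∉ N
      isCuspidal_iff := fun 𝔭 => by
        constructor
        · rintro h𝔭 a ⟨ha, rfl⟩
          exact ⟨ha, h𝔭⟩
        · intro hall
          obtain ⟨⟨a, ha⟩, rfl⟩ := Quotient.exists_rep 𝔭
          obtain ⟨ha', hnot⟩ := hall a ⟨ha, rfl⟩
          exact hnot
      ncspIso := fun 𝔭 𝔮 _ _ => Classical.choice (hiso 𝔭 𝔮)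
      cspIso := fun 𝔭 𝔮 _ _ => Classical.choice (hiso 𝔭 𝔮)
      cspToNcsp := fun 𝔭 => ⟨(f ⟨𝔭.1, 𝔭.2⟩ : Primes 𝔉.PhiAcirc), not_not.mpr (f ⟨𝔭.1, 𝔭.2⟩).2⟩
      cspToNcsp_surjective := by
        rintro ⟨𝔮, h𝔮⟩
        obtain ⟨x, hx⟩ := hf ⟨𝔮, not_not.mp h𝔮⟩
        refine ⟨x, Subtype.ext ?_⟩
        have hx' : ((f x : N) : Primes 𝔉.PhiAcirc) = 𝔮 := congrArg Subtype.val hx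
        exact hx'
      ncspEquivZ := (Equiv.subtypeEquivRight fun 𝔭 => not_not).trans eN
      divTheta := 1 }
  have hc : CuspPreserved 𝔓 (CategoryTheory.Equivalence.refl (C := C)) (Iso.refl 𝔉.Acirc) σ := fun 𝔭 => by
    change Primes.congr (psiPhi 𝔉 (CategoryTheory.Equivalence.refl (C := C)) (Iso.refl 𝔉.Acirc) σ) 𝔭 ∉ N ↔ 𝔭 ∉ N
    rw [psiPhi_refl]
    exact not_congr (hN 𝔭)
  refine ⟨𝔓, hc, fun H => hmove ?_⟩
  have hfix : Primes.congr (psiPhi 𝔉 (CategoryTheory.Equivalence.refl (C := C)) (Iso.refl 𝔉.Acirc) σ) 𝔞 = 𝔞 := by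
    rw [psiPhi_refl]; exact hσ𝔞
  have h1 := H 𝔞 h𝔞
  have h2 : (𝔓.cspToNcsp ⟨Primes.congr (psiPhi 𝔉 (CategoryTheory.Equivalence.refl (C := C)) (Iso.refl 𝔉.Acirc) σ) 𝔞,
        (hc 𝔞).mpr h𝔞⟩ : Primes 𝔉.PhiAcirc) = (𝔓.cspToNcsp ⟨𝔞, h𝔞⟩ : Primes 𝔉.PhiAcirc) :=
    congrArg (fun x : {𝔭 // 𝔓.IsCuspidal 𝔭} => (𝔓.cspToNcsp x : Primes 𝔉.PhiAcirc)) (Subtype.ext hfix)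
  rw [h2, psiPhi_refl] at h1
  exact h1.symm

/-- **F-0560: at every such `𝔉` the closure of the row over the stub data is false** — it is NOT the case that
`PreservesCspToNcsp 𝔓 Ψ ι e hc` holds for all `DivisorPrimeData 𝔓`, all `Ψ, ι, e` and all proofs `hc` of (i) on
primes.  The FACT-LIST row is admissible at named instances only (instance form:
`preservesCspToNcsp_of_criterion`, `Discharge/Sec5Prop53Surjection.lean`).
[cite: MochizukiEtTh2009, Prop 5.3 (iv) p.325 (PDF p.99)] -/
theorem not_forall_preservesCspToNcsp_of_config (σ : 𝔉.PhiAcirc ≃* 𝔉.PhiAcirc) (N : Set (Primes 𝔉.PhiAcirc))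
    (hN : ∀ 𝔭, Primes.congr σ 𝔭 ∈ N ↔ 𝔭 ∈ N) (eN : N ≃ ℤ) (f : {𝔭 // 𝔭 ∉ N} → N)
    (hf : Function.Surjective f) (𝔞 : Primes 𝔉.PhiAcirc) (h𝔞 : 𝔞 ∉ N) (hσ𝔞 : Primes.congr σ 𝔞 = 𝔞)
    (hmove : Primes.congr σ (f ⟨𝔞, h𝔞⟩ : Primes 𝔉.PhiAcirc) ≠ f ⟨𝔞, h𝔞⟩)
    (hiso : ∀ 𝔭 𝔮 : Primes 𝔉.PhiAcirc, Nonempty (𝔭.submonoid ≃* 𝔮.submonoid)) :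
    ¬ ∀ (𝔓 : DivisorPrimeData 𝔉) (Ψ : C ≌ C) (ι : Ψ.functor.obj 𝔉.Acirc ≅ 𝔉.Acirc)
        (e : 𝔉.PhiAcirc ≃* 𝔉.pre.Mon (𝔉.base.obj (Ψ.functor.obj 𝔉.Acirc))) (hc : CuspPreserved 𝔓 Ψ ι e),
        Literature.AnabelianGeometry.EtaleTheta.FrobenioidThetaDivisors.PreservesCspToNcsp 𝔓 Ψ ι e hc := by
  intro H
  obtain ⟨𝔓, hc, hnot⟩ := exists_not_preservesCspToNcsp 𝔉 σ N hN eN f hf 𝔞 h𝔞 hσ𝔞 hmove hiso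
  exact hnot (H 𝔓 (CategoryTheory.Equivalence.refl (C := C)) (Iso.refl 𝔉.Acirc) σ hc)

end FrobenioidThetaDivisors

end Literature.AnabelianGeometry.EtaleTheta
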